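import Literature.AlgebraicGeometry.Resolution.HasseSchmidtBlowupChart
import Mathlib.Algebra.BigOperators.NatAntidiagonal
import HarnessLib

/-!
# Hasse–Schmidt derivations along a TOWER of blow-up charts: the logarithmic lemma, the tower Giraud
  identity, and the two-sided order criterion for controlled transforms (every characteristic, every field)

Topic: `Literature/AlgebraicGeometry/Resolution`. Companion of `HasseSchmidtTransverseOrder.lean` (one point:
`J ⊆ 𝔪^b ⟺ Σ_{i<b} (Diff^{≤ i} J)^{b!/(b-i)} ⊆ 𝔪^{b!} + (u)` for a regular local ring carrying a Hasse–Schmidt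
derivation `D` with `D_1 u` a unit) and of `HasseSchmidtBlowupChart.lean` (ONE chart: the rescaled derivation
`(a^n D_n)_n` preserves `A[I/a]` and `u/a` stays transverse).  That file says what it does NOT contain: "the comparison
of `(J')♯` with the transform of `J♯` (the ideal-theoretic content of the LSB clause)" of an ambient-reduction /
restriction theorem ALONG A SEQUENCE of blow-ups.  The present file supplies a substitute for that comparison which
needs no Diff-closedness, no completion, no local retraction and no hypothesis on the base: along a tower of `k`
charts with denominators `g_0, …, g_{k-1}` and accumulated denominator `G = g_0 ⋯ g_{k-1}`, the controlled
transform `f G^{-b}` and the controlled transforms `(D_e f) G^{-(b-e)}` (`e < b`) of the generators of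
`Σ_e Diff^{(e)}`-data are tied together by a UNITRIANGULAR system with coefficients in the top ring `O_k`
(the *tower Giraud identity*), whence a two-sided order criterion at the points of the strict transform of `V(u)`.

## Content (all rings commutative; `K` a field containing the tower; `D` a Hasse–Schmidt derivation of `K`)

* `HasseSchmidtDerivation.restrict` — restriction of `D` to a subalgebra it preserves.
* **Logarithmic lemma** (`inv_pow_mul_op_pow_mem`, `pow_mul_op_inv_pow_mem`): if `D` preserves a subalgebra
  `S ∋ g`, `g ≠ 0`, then for all `m, n ≥ 0` both `g^{-m} · g^n D_n(g^m)` and `g^{m} · g^n D_n(g^{-m})` lie in `S`: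
  the `g`-RESCALED derivation `(g^n D_n)_n` maps `g^m S` to `g^m S` for every `m ∈ ℤ` (logarithmic behaviour along
  `V(g)`), although `D` itself does not (`S = k[x]_{(x)}`, `g = x`, `D` = Hasse derivatives in `x`:
  `x · D_1(x^{-1}) = -x^{-1} ∉ S`).
* **Towers** (`IsChartTower D O g k`): subalgebras `O_0 ≤ O_1 ≤ ⋯ ≤ O_k` of `K`, elements `g_j ∈ O_j`, `g_j ≠ 0`,
  such that the rescaled derivation `(G_j^n D_n)_n`, `G_j = Π_{i<j} g_i` (`tprod g j`), preserves `O_j` for every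
  `j ≤ k` — exactly what `HasseSchmidtBlowupChart.lean` produces chart by chart (`O_{j+1} ⊇ O_j[I_j/g_j]`,
  `awayRescale`).  Then: `IsChartTower.pow_mul_op_inv_pow_mem` (**log-tower lemma**: `G^m · G^n D_n(G^{-m}) ∈ O_k`),
  `op_one_tprod_mem` (`D_1 G ∈ O_k`), `towerDeriv` (the Hasse–Schmidt derivation `(G^n D_n)_n` OF `O_k`),
  `isUnit_towerDeriv_op_one` (**transversality persists along the tower**: `u = u_k G`, `u_k ∈ 𝔪(O_k)`, `D_1 u` a
  unit of `O_k` ⟹ `G D_1(u_k) = D_1 u - u_k D_1 G` is a unit of `O_k`).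
* **Tower Giraud identity** (`pow_mul_op_mul_inv_pow`, `towerDeriv_op_eq_sum`):
  `G^c D_c(f G^{-b}) = Σ_{e ≤ c} [(D_e f) G^{-(b-e)}] · [G^b · G^{c-e} D_{c-e}(G^{-b})]`, the second brackets in
  `O_k` by the log-tower lemma and equal to `1` for `e = c` (`towerCoeff_zero`).
* **Two-sided order criterion** (`IsChartTower.mem_pow_iff_forall_pow_mem_sup`): `O_k` regular local,
  `u_k = u/G ∈ 𝔪_k`, `D_1 u ∈ O_k^×`, `f_k = f G^{-b} ∈ O_k` and `x_e = (D_e f) G^{-(b-e)} ∈ O_k` (`e < b`). Then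
  `f_k ∈ 𝔪_k^b ⟺ ∀ e < b, x_e^{b!/(b-e)} ∈ 𝔪_k^{b!} + (u_k)`.
  (⟹ by descending the unitriangular system, `mem_pow_sub_of_op_eq_sum`; ⟸ by root extraction in the regular local
  ring `O_k/(u_k)` — `Ideal.pow_le_pow_mul_sup_span_iff` — and the transverse-order core
  `mem_pow_of_forall_apply_mem_sup` of `HasseSchmidtTransverseOrder.lean`, fed through the unitriangular system,
  `mem_pow_of_op_eq_sum`.)

## Role (what this is used for, and what is NOT here)

Read at the local rings `O_k = O_{Z_k,η_k}` of the generic points of the centres of a sequence of blow-ups with regular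
centres inside the strict transforms `W_k = V(u_k)` of a hypersurface `W = V(u)` smooth over the base field, the
criterion says: the controlled transform of `(J, b)` has order `≥ b` at `η_k` iff the controlled transforms (exponent
`b!`, taken INSIDE the strict transform `W_k`, whose local ring is `O_k/(u_k)`) of the generators
`Π (D_{e} f)^{b!/(b-e)}` of `J♯|_W = (Σ_{e<b} (Diff^{(e)} J)^{b!/(b-e)})|_W` have order `≥ b!` — the stage-`k` step of
the "LSB clause" of an ambient reduction to a smooth HYPERSURFACE in every characteristic over every field, with no
comparison of `(J_k)♯` with `(J♯)_k` (only the unitriangular identity above).  The remaining, non-transversal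
generators of `J♯` are handled on the valuative side (`Hironaka2017/TreeValuativeDiff.lean`, `perm_apply`).  The
sequence-level assembly (generic points, honesty of the transforms, strict transforms of `W`, the `t`-variables) is
prose kept by the `pub-hironaka` repair cell (STEPS.md §B.10); [Hironaka2017] is an UNREFEREED manuscript and nothing
of it is asserted here.  NOT here: smooth subschemes `W` of codimension `≥ 2` (these need the Diff-closedness of
`Diff(G)`, [BGV12] Thm. 3.4, in print for perfect base fields), sheaves, gluing of charts.

## Sources

* J. Giraud, *Contact maximal en caractéristique positive*, Ann. Sci. ÉNS 8 (1975) — transforms of differential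
  operators under blowing up (Giraud's lemma). [Giraud1975]
* A. Bravo, M. L. García-Escamilla, O. Villamayor U., arXiv:1107.1797: Lemma 4.6 p. 15 (Giraud's lemma for
  `Diff`-data), Prop. 6.9 pp. 20–21 (restriction to a smooth hypersurface and its stability under local sequences,
  argued there with local retractions over a perfect field). [BravoGarciaEscamillaVillamayor2012]
* H. Matsumura, *Commutative Ring Theory*, §27 (higher derivations), Thm. 14.2 (regular local rings modulo a
  parameter). [Matsumura1987]
* H. Hironaka, *Resolution of singularities in positive characteristics* (ms. 2017), Th. 3.10 p. 10 (the Ambient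
  Reduction Theorem, audited text only). [Hironaka2017]
-/

noncomputable section

open IsLocalRing Finset

namespace Literature.AlgebraicGeometry.Resolution

namespace HasseSchmidtDerivation

universe u v

/-! ### Restriction to a preserved subalgebra -/

section Restrict

variable {R : Type u} {A : Type v} [CommRing R] [CommRing A] [Algebra R A]
  (D : HasseSchmidtDerivation R A) (S : Subalgebra R A)
  (hS : ∀ (n : ℕ) (x : A), x ∈ S → D.op n x ∈ S)

/-- The components of `D` as linear endomorphisms of a subalgebra `S` preserved by every `D_n`. [folklore] -/
def restrictOp (n : ℕ) : S →ₗ[R] S where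
  toFun x := ⟨D.op n x, hS n x x.2⟩
  map_add' x y := Subtype.ext (by simp)
  map_smul' c x := Subtype.ext (by simp)

/-- `(D|_S)_n x = D_n x` in `A`. [folklore] -/
@[simp] theorem coe_restrictOp_apply (n : ℕ) (x : S) : ((D.restrictOp S hS n x : S) : A) = D.op n x := rfl

/-- **Restriction of a Hasse–Schmidt derivation to a subalgebra preserved by all its components** is again a
Hasse–Schmidt derivation (the Leibniz rule is inherited). [cite: Matsumura1987, §27] -/
def restrict : HasseSchmidtDerivation R S where
  op := D.restrictOp S hS
  op_zero := LinearMap.ext fun x => Subtype.ext (by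
    rw [coe_restrictOp_apply, op_zero_apply, LinearMap.id_apply])
  leibniz n f g := Subtype.ext (by
    rw [coe_restrictOp_apply, Subalgebra.coe_mul, D.leibniz, AddSubmonoidClass.coe_finsetSum]
    simp only [Subalgebra.coe_mul, coe_restrictOp_apply])

/-- `((D|_S)_n x : A) = D_n x`. [folklore] -/
@[simp] theorem coe_restrict_op_apply (n : ℕ) (x : S) : (((D.restrict S hS).op n x : S) : A) = D.op n x :=
  rfl

end Restrict

/-! ### The logarithmic lemma for a rescaled derivation -/

section Log

variable {R : Type u} {K : Type v} [CommRing R] [Field K] [Algebra R K]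
  (D : HasseSchmidtDerivation R K) {S : Subalgebra R K}
  (hS : ∀ (n : ℕ) (x : K), x ∈ S → D.op n x ∈ S)

include hS

/-- `g^{-1} · g^j D_j(g) ∈ S` for `g ∈ S ∖ 0` (trivial: for `j ≥ 1` it is `g^{j-1} D_j g`). [folklore] -/
theorem inv_mul_pow_mul_op_self_mem {g : K} (hg : g ∈ S) (hg0 : g ≠ 0) :
    ∀ j : ℕ, g⁻¹ * (g ^ j * D.op j g) ∈ S
  | 0 => by
    rw [pow_zero, op_zero_apply, one_mul, inv_mul_cancel₀ hg0]
    exact S.one_mem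
  | j + 1 => by
    rw [show g⁻¹ * (g ^ (j + 1) * D.op (j + 1) g) = g⁻¹ * g * (g ^ j * D.op (j + 1) g) by ring,
      inv_mul_cancel₀ hg0, one_mul]
    exact S.mul_mem (S.pow_mem hg j) (hS _ _ hg)

/-- **Logarithmic lemma, positive powers**: if every `D_n` preserves `S ∋ g`, `g ≠ 0`, then
`g^{-m} · g^n D_n(g^m) ∈ S` for all `m, n` — the rescaled derivation `(g^n D_n)_n` maps `g^m S` into `g^m S`.
(Leibniz on `g^{m+1} = g^m · g`.) [cite: BravoGarciaEscamillaVillamayor2012, Lemma 4.6] -/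
theorem inv_pow_mul_op_pow_mem {g : K} (hg : g ∈ S) (hg0 : g ≠ 0) :
    ∀ m n : ℕ, (g ^ m)⁻¹ * (g ^ n * D.op n (g ^ m)) ∈ S := by
  intro m
  induction m with
  | zero =>
    intro n
    rw [pow_zero, inv_one, one_mul]
    exact S.mul_mem (S.pow_mem hg n) (hS n 1 S.one_mem)
  | succ m ih =>
    intro n
    rw [pow_succ, D.leibniz n (g ^ m) g, Finset.mul_sum, Finset.mul_sum]
    refine Subalgebra.sum_mem S fun p hp => ?_
    have hpn : p.1 + p.2 = n := mem_antidiagonal.mp hp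
    have key : (g ^ m * g)⁻¹ * (g ^ n * (D.op p.1 (g ^ m) * D.op p.2 g)) =
        (g ^ m)⁻¹ * (g ^ p.1 * D.op p.1 (g ^ m)) * (g⁻¹ * (g ^ p.2 * D.op p.2 g)) := by
      rw [mul_inv, ← hpn, pow_add]; ring
    rw [key]
    exact S.mul_mem (ih p.1) (D.inv_mul_pow_mul_op_self_mem hS hg hg0 p.2)

/-- **Logarithmic lemma, negative powers**: if every `D_n` preserves `S ∋ g`, `g ≠ 0`, then
`g^{m} · g^n D_n(g^{-m}) ∈ S` for all `m, n` — the rescaled derivation `(g^n D_n)_n` maps `g^{-m} S` into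
`g^{-m} S` (strong induction on `n` through `0 = D_n(g^m · g^{-m})`, `n ≥ 1`).  Without the rescaling this fails:
`S = k[x]_{(x)}`, `g = x`, `x · D_1(1/x) = -1/x`. [cite: BravoGarciaEscamillaVillamayor2012, Lemma 4.6] -/
theorem pow_mul_op_inv_pow_mem {g : K} (hg : g ∈ S) (hg0 : g ≠ 0) (m : ℕ) :
    ∀ n : ℕ, g ^ m * (g ^ n * D.op n (g ^ m)⁻¹) ∈ S := by
  have hgm : g ^ m ≠ 0 := pow_ne_zero m hg0
  intro n
  induction n using Nat.strong_induction_on with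
  | _ n ih =>
    cases n with
    | zero =>
      rw [pow_zero, op_zero_apply, one_mul, mul_inv_cancel₀ hgm]
      exact S.one_mem
    | succ n =>
      have h0 : D.op (n + 1) (g ^ m * (g ^ m)⁻¹) = 0 := by
        rw [mul_inv_cancel₀ hgm, op_succ_apply_one]
      rw [D.leibniz, Finset.Nat.sum_antidiagonal_succ, op_zero_apply] at h0
      have h0' : g ^ m * D.op (n + 1) (g ^ m)⁻¹ =
          -∑ p ∈ antidiagonal n, D.op (p.1 + 1) (g ^ m) * D.op p.2 (g ^ m)⁻¹ :=
        eq_neg_of_add_eq_zero_left h0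
      have h1 : g ^ m * (g ^ (n + 1) * D.op (n + 1) (g ^ m)⁻¹) =
          -∑ p ∈ antidiagonal n, (g ^ m)⁻¹ * (g ^ (p.1 + 1) * D.op (p.1 + 1) (g ^ m)) *
            (g ^ m * (g ^ p.2 * D.op p.2 (g ^ m)⁻¹)) := by
        calc g ^ m * (g ^ (n + 1) * D.op (n + 1) (g ^ m)⁻¹)
            = g ^ (n + 1) * (g ^ m * D.op (n + 1) (g ^ m)⁻¹) := by ring
          _ = -∑ p ∈ antidiagonal n, g ^ (n + 1) * (D.op (p.1 + 1) (g ^ m) * D.op p.2 (g ^ m)⁻¹) := by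
            rw [h0', mul_neg, Finset.mul_sum]
          _ = _ := by
            rw [neg_inj]
            refine Finset.sum_congr rfl fun p hp => ?_
            have hpn : p.1 + p.2 = n := mem_antidiagonal.mp hp
            calc g ^ (n + 1) * (D.op (p.1 + 1) (g ^ m) * D.op p.2 (g ^ m)⁻¹)
                = (g ^ m)⁻¹ * g ^ m * (g ^ (p.1 + 1) * g ^ p.2) *
                    (D.op (p.1 + 1) (g ^ m) * D.op p.2 (g ^ m)⁻¹) := by
                  rw [inv_mul_cancel₀ hgm, one_mul, ← pow_add, show p.1 + 1 + p.2 = n + 1 by omega]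
              _ = _ := by ring
      rw [h1]
      refine S.neg_mem (Subalgebra.sum_mem S fun p hp => S.mul_mem ?_ ?_)
      · exact D.inv_pow_mul_op_pow_mem hS hg hg0 m (p.1 + 1)
      · have hpn : p.1 + p.2 = n := mem_antidiagonal.mp hp
        exact ih p.2 (by omega)

end Log

/-! ### Towers of charts -/

section Tower

variable {R : Type u} {K : Type v} [CommRing R] [Field K] [Algebra R K]
  (D : HasseSchmidtDerivation R K) (O : ℕ → Subalgebra R K) (g : ℕ → K)

/-- The accumulated denominator `G_j = g_0 g_1 ⋯ g_{j-1}` of the first `j` charts. [folklore] -/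
def tprod (g : ℕ → K) (j : ℕ) : K := ∏ i ∈ Finset.range j, g i

/-- `G_0 = 1`. [folklore] -/
@[simp] theorem tprod_zero : tprod g 0 = 1 := by simp [tprod]

/-- `G_{j+1} = G_j g_j`. [folklore] -/
theorem tprod_succ (j : ℕ) : tprod g (j + 1) = tprod g j * g j := by
  simp [tprod, Finset.prod_range_succ]

/-- **A tower of `k` charts** for a Hasse–Schmidt derivation `D` of the common fraction field `K`: subalgebras
`O_0 ≤ ⋯ ≤ O_k`, denominators `g_j ∈ O_j ∖ 0` (`j < k`), and for every `j ≤ k` the rescaled derivation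
`(G_j^n D_n)_n`, `G_j = g_0 ⋯ g_{j-1}`, preserves `O_j` (what `HasseSchmidtBlowupChart.lean` provides chart by
chart: `O_{j+1}` a localisation of `O_j[I_j/g_j]` at a point, `awayRescale_op_mem_blowupAlgebra`, `localize`).
[cite: BravoGarciaEscamillaVillamayor2012, Lemma 4.6] -/
structure IsChartTower (k : ℕ) : Prop where
  /-- the rings increase -/
  mono : ∀ ⦃i j : ℕ⦄, i ≤ j → j ≤ k → O i ≤ O j
  /-- the `j`-th denominator lives at level `j` -/
  mem : ∀ ⦃j : ℕ⦄, j < k → g j ∈ O j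
  /-- and is non-zero -/
  ne_zero : ∀ ⦃j : ℕ⦄, j < k → g j ≠ 0
  /-- the rescaled derivation `(G_j^n D_n)_n` preserves `O_j` -/
  preserves : ∀ ⦃j : ℕ⦄, j ≤ k → ∀ (n : ℕ) (x : K), x ∈ O j → tprod g j ^ n * D.op n x ∈ O j

/-- **Tower Giraud identity** (in `K`, for any `G ≠ 0`):
`G^c D_c(f G^{-b}) = Σ_{e ≤ c} [D_e f · G^e G^{-b}] · [G^b · G^{c-e} D_{c-e}(G^{-b})]`. (Leibniz.)
[cite: BravoGarciaEscamillaVillamayor2012, Lemma 4.6] -/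
theorem pow_mul_op_mul_inv_pow {G : K} (hG : G ≠ 0) (f : K) (b c : ℕ) :
    G ^ c * D.op c (f * (G ^ b)⁻¹) =
      ∑ e ∈ Finset.range (c + 1),
        D.op e f * (G ^ e * (G ^ b)⁻¹) * (G ^ b * (G ^ (c - e) * D.op (c - e) (G ^ b)⁻¹)) := by
  have hGb : G ^ b ≠ 0 := pow_ne_zero b hG
  rw [D.leibniz c f, Finset.Nat.sum_antidiagonal_eq_sum_range_succ_mk, Finset.mul_sum]
  refine Finset.sum_congr rfl fun e he => ?_
  have hec : e ≤ c := Nat.lt_succ_iff.mp (Finset.mem_range.mp he)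
  dsimp only
  calc G ^ c * (D.op e f * D.op (c - e) (G ^ b)⁻¹)
      = (G ^ b)⁻¹ * G ^ b * (G ^ e * G ^ (c - e)) * (D.op e f * D.op (c - e) (G ^ b)⁻¹) := by
        rw [inv_mul_cancel₀ hGb, one_mul, ← pow_add, Nat.add_sub_cancel' hec]
    _ = _ := by ring

/-- `G^e G^{-b} = G^{-(b-e)}` for `e ≤ b`. [folklore] -/
theorem pow_mul_inv_pow_eq {G : K} (hG : G ≠ 0) {e b : ℕ} (he : e ≤ b) :
    G ^ e * (G ^ b)⁻¹ = (G ^ (b - e))⁻¹ := by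
  have hGe : G ^ e ≠ 0 := pow_ne_zero e hG
  rw [show G ^ b = G ^ e * G ^ (b - e) by rw [← pow_add, Nat.add_sub_cancel' he], mul_inv,
    ← mul_assoc, mul_inv_cancel₀ hGe, one_mul]

variable {D O g}

namespace IsChartTower

variable {k : ℕ}

/-- A tower of `k` charts restricts to a tower of `j ≤ k` charts. [folklore] -/
theorem of_le (h : IsChartTower D O g k) {j : ℕ} (hj : j ≤ k) : IsChartTower D O g j where
  mono _ _ hij hjj := h.mono hij (hjj.trans hj)
  mem _ hjj := h.mem (lt_of_lt_of_le hjj hj)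
  ne_zero _ hjj := h.ne_zero (lt_of_lt_of_le hjj hj)
  preserves _ hjj := h.preserves (hjj.trans hj)

/-- `G_k ∈ O_k`. [folklore] -/
theorem tprod_mem (h : IsChartTower D O g k) : tprod g k ∈ O k := by
  refine Subalgebra.prod_mem _ fun i hi => ?_
  have hik : i < k := Finset.mem_range.mp hi
  exact h.mono hik.le le_rfl (h.mem hik)

/-- `G_k ≠ 0`. [folklore] -/
theorem tprod_ne_zero (h : IsChartTower D O g k) : tprod g k ≠ 0 :=
  Finset.prod_ne_zero_iff.mpr fun _ hi => h.ne_zero (Finset.mem_range.mp hi)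

/-- `D` preserves `O_0` (the case `j = 0`, `G_0 = 1`). [folklore] -/
theorem op_mem_zero (h : IsChartTower D O g k) (n : ℕ) {x : K} (hx : x ∈ O 0) : D.op n x ∈ O 0 := by
  simpa using h.preserves (Nat.zero_le k) n x hx

/-- **Log-tower lemma**: `G_k^m · G_k^n D_n(G_k^{-m}) ∈ O_k` for all `m, n` — the rescaled derivation
`(G_k^n D_n)_n` maps `G_k^{-m} O_k` into itself.  (Induction on `k`: `G_{k+1} = G_k g_k`, Leibniz, the log-tower
lemma for `G_k` and the logarithmic lemma `pow_mul_op_inv_pow_mem` for `g_k` with respect to the derivation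
`(G_k^n D_n)_n`, which preserves `O_k ∋ g_k`.) [cite: BravoGarciaEscamillaVillamayor2012, Lemma 4.6] -/
theorem pow_mul_op_inv_pow_mem (h : IsChartTower D O g k) (m n : ℕ) :
    tprod g k ^ m * (tprod g k ^ n * D.op n (tprod g k ^ m)⁻¹) ∈ O k := by
  induction k generalizing n with
  | zero =>
    rw [tprod_zero, one_pow, one_pow, inv_one, one_mul, one_mul]
    exact h.op_mem_zero n (O 0).one_mem
  | succ k ih =>
    have h' : IsChartTower D O g k := h.of_le (Nat.le_succ k)
    have hle : O k ≤ O (k + 1) := h.mono (Nat.le_succ k) le_rfl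
    have hgk : g k ∈ O k := h.mem (Nat.lt_succ_self k)
    have hgk0 : g k ≠ 0 := h.ne_zero (Nat.lt_succ_self k)
    rw [tprod_succ, mul_pow, mul_pow, mul_inv, D.leibniz n, Finset.mul_sum, Finset.mul_sum]
    refine Subalgebra.sum_mem _ fun p hp => ?_
    have hpn : p.1 + p.2 = n := mem_antidiagonal.mp hp
    have key : tprod g k ^ m * g k ^ m * (tprod g k ^ n * g k ^ n *
        (D.op p.1 (tprod g k ^ m)⁻¹ * D.op p.2 (g k ^ m)⁻¹)) =
        g k ^ p.1 * (tprod g k ^ m * (tprod g k ^ p.1 * D.op p.1 (tprod g k ^ m)⁻¹)) *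
          (g k ^ m * (g k ^ p.2 * (tprod g k ^ p.2 * D.op p.2 (g k ^ m)⁻¹))) := by
      rw [← hpn, pow_add, pow_add]; ring
    rw [key]
    refine (O (k + 1)).mul_mem ((O (k + 1)).mul_mem ((O (k + 1)).pow_mem (hle hgk) _) (hle (ih h' p.1)))
      (hle ?_)
    have hpres : ∀ (n : ℕ) (x : K), x ∈ O k → (D.rescale (tprod g k)).op n x ∈ O k :=
      fun n x hx => h'.preserves le_rfl n x hx
    simpa only [rescale_op_apply] using
      (D.rescale (tprod g k)).pow_mul_op_inv_pow_mem hpres hgk hgk0 m p.2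

/-- `D_1(G_k) ∈ O_k` (induction on `k`: `D_1(G_k g_k) = G_k D_1 g_k + D_1(G_k) g_k`). [folklore] -/
theorem op_one_tprod_mem (h : IsChartTower D O g k) : D.op 1 (tprod g k) ∈ O k := by
  induction k with
  | zero =>
    rw [tprod_zero, op_succ_apply_one]
    exact (O 0).zero_mem
  | succ k ih =>
    have h' : IsChartTower D O g k := h.of_le (Nat.le_succ k)
    have hle : O k ≤ O (k + 1) := h.mono (Nat.le_succ k) le_rfl
    have hgk : g k ∈ O k := h.mem (Nat.lt_succ_self k)
    rw [tprod_succ, op_one_mul]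
    refine (O (k + 1)).add_mem (hle ?_) ((O (k + 1)).mul_mem (hle (ih h')) (hle hgk))
    simpa using h'.preserves le_rfl 1 (g k) hgk

/-- **The Hasse–Schmidt derivation `(G_k^n D_n)_n` of the top ring `O_k`** of a tower. [folklore] -/
def towerDeriv (h : IsChartTower D O g k) : HasseSchmidtDerivation R (O k) :=
  (D.rescale (tprod g k)).restrict (O k) fun n x hx => h.preserves le_rfl n x hx

/-- `((G^n D_n)|_{O_k} x : K) = G_k^n D_n x`. [folklore] -/
@[simp] theorem coe_towerDeriv_op_apply (h : IsChartTower D O g k) (n : ℕ) (x : O k) :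
    (((towerDeriv h).op n x : O k) : K) = tprod g k ^ n * D.op n x :=
  rfl

/-- In a local ring, a unit minus an element of the maximal ideal is a unit. [folklore] -/
theorem isUnit_sub_of_mem_maximalIdeal {T : Type*} [CommRing T] [IsLocalRing T] {x y : T}
    (hx : IsUnit x) (hy : y ∈ maximalIdeal T) : IsUnit (x - y) := by
  by_contra hxy
  have hxy' : x - y ∈ maximalIdeal T := (mem_maximalIdeal _).mpr (mem_nonunits_iff.mpr hxy)
  have hx' : x ∈ maximalIdeal T := by simpa using Ideal.add_mem _ hxy' hy
  exact mem_nonunits_iff.mp ((mem_maximalIdeal _).mp hx') hx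

/-- **Transversality persists along the tower**: if `u = u_k · G_k` with `u_k` in the maximal ideal of the local
ring `O_k` and `D_1 u` (an element of `O_k`) a unit of `O_k`, then `(G_k D_1)(u_k) = D_1 u - u_k · D_1(G_k)` is a
unit of `O_k`.  (The `k`-fold iterate of `HasseSchmidtBlowupChart.transform_op_one`.)
[cite: BravoGarciaEscamillaVillamayor2012, Prop. 6.9] -/
theorem isUnit_towerDeriv_op_one (h : IsChartTower D O g k) [IsLocalRing (O k)] {u : K} (uk d : O k)
    (huk : (uk : K) * tprod g k = u) (hum : uk ∈ maximalIdeal (O k)) (hd : (d : K) = D.op 1 u)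
    (hdU : IsUnit d) : IsUnit ((towerDeriv h).op 1 uk) := by
  have hkey : (((towerDeriv h).op 1 uk : O k) : K) = d - uk * D.op 1 (tprod g k) := by
    rw [coe_towerDeriv_op_apply, pow_one, hd, ← huk, op_one_mul]; ring
  have hkey' : (towerDeriv h).op 1 uk = d - uk * ⟨D.op 1 (tprod g k), h.op_one_tprod_mem⟩ :=
    Subtype.ext (by rw [hkey, Subalgebra.coe_sub, Subalgebra.coe_mul])
  rw [hkey']
  exact isUnit_sub_of_mem_maximalIdeal hdU (Ideal.mul_mem_right _ _ hum)

/-- The coefficients `t_a = G^b · G^a D_a(G^{-b}) ∈ O_k` of the tower Giraud identity. [folklore] -/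
def towerCoeff (h : IsChartTower D O g k) (b a : ℕ) : O k :=
  ⟨tprod g k ^ b * (tprod g k ^ a * D.op a (tprod g k ^ b)⁻¹), h.pow_mul_op_inv_pow_mem b a⟩

/-- `(t_a : K) = G^b · G^a D_a(G^{-b})`. [folklore] -/
@[simp] theorem coe_towerCoeff (h : IsChartTower D O g k) (b a : ℕ) :
    ((towerCoeff h b a : O k) : K) = tprod g k ^ b * (tprod g k ^ a * D.op a (tprod g k ^ b)⁻¹) :=
  rfl

/-- `t_0 = 1` (the system is unitriangular). [folklore] -/
theorem towerCoeff_zero (h : IsChartTower D O g k) (b : ℕ) : towerCoeff h b 0 = 1 := by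
  refine Subtype.ext ?_
  rw [coe_towerCoeff, pow_zero, op_zero_apply, one_mul, mul_inv_cancel₀ (pow_ne_zero b h.tprod_ne_zero),
    Subalgebra.coe_one]

/-- **Tower Giraud identity in `O_k`**: if `f_k = f G^{-b}` and `x_e = (D_e f) G^{-(b-e)}` (`e ≤ c`) lie in `O_k`,
then `(G^c D_c)(f_k) = Σ_{e ≤ c} x_e t_{c-e}` with the `t`'s of `towerCoeff` (`c ≤ b`).
[cite: BravoGarciaEscamillaVillamayor2012, Lemma 4.6] -/
theorem towerDeriv_op_eq_sum (h : IsChartTower D O g k) {f : K} {b c : ℕ} (hcb : c ≤ b) (fk : O k)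
    (x : ℕ → O k) (hfk : (fk : K) = f * (tprod g k ^ b)⁻¹)
    (hx : ∀ e ≤ c, (x e : K) = D.op e f * (tprod g k ^ (b - e))⁻¹) :
    (towerDeriv h).op c fk = ∑ e ∈ Finset.range (c + 1), x e * towerCoeff h b (c - e) := by
  refine Subtype.ext ?_
  rw [coe_towerDeriv_op_apply, hfk, D.pow_mul_op_mul_inv_pow h.tprod_ne_zero, AddSubmonoidClass.coe_finsetSum]
  refine Finset.sum_congr rfl fun e he => ?_
  have hec : e ≤ c := Nat.lt_succ_iff.mp (Finset.mem_range.mp he)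
  rw [Subalgebra.coe_mul, coe_towerCoeff, hx e hec, pow_mul_inv_pow_eq h.tprod_ne_zero (hec.trans hcb)]

end IsChartTower

end Tower

/-! ### The two-sided order criterion -/

section Criterion

variable {R : Type u} {A : Type v} [CommSemiring R] [CommRing A] [Algebra R A]
  (Δ : HasseSchmidtDerivation R A)

/-- **Descending a unitriangular system** (⟸ of the criterion, every ring): `u ∈ P`, `Δ_1 u` a unit,
`Δ_c f = Σ_{e ≤ c} x_e t_{c,e}` for all `c < b`, and `x_e ∈ P^{b-e} + (u)` for all `e < b` ⟹ `f ∈ P^b`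
(since then `Δ_c f ∈ P^{b-c} + (u)` for all `c < b`: `mem_pow_of_forall_apply_mem_sup`).
[cite: BravoGarciaEscamillaVillamayor2012, Prop. 6.9] -/
theorem mem_pow_of_op_eq_sum {P : Ideal A} {u : A} (hu : u ∈ P) (hΔu : IsUnit (Δ.op 1 u)) {b : ℕ}
    {f : A} {x : ℕ → A}
    (hΔ : ∀ c < b, ∃ t : ℕ → A, Δ.op c f = ∑ e ∈ Finset.range (c + 1), x e * t e)
    (hx : ∀ e < b, x e ∈ P ^ (b - e) ⊔ Ideal.span {u}) : f ∈ P ^ b := by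
  refine Δ.mem_pow_of_forall_apply_mem_sup hu hΔu b fun c hc => ?_
  obtain ⟨t, ht⟩ := hΔ c hc
  rw [ht]
  refine Ideal.sum_mem _ fun e he => Ideal.mul_mem_right _ _ ?_
  have hec : e ≤ c := Nat.lt_succ_iff.mp (Finset.mem_range.mp he)
  have hle : P ^ (b - e) ⊔ Ideal.span {u} ≤ P ^ (b - c) ⊔ Ideal.span {u} :=
    sup_le_sup_right (Ideal.pow_le_pow_right (by omega)) _
  exact hle (hx e (by omega))

/-- **Ascending a unitriangular system** (⟹ of the criterion, every ring): `f ∈ P^b` and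
`Δ_c f = Σ_{e ≤ c} x_e t_{c,e}` with `t_{c,c} = 1` for all `c < b` ⟹ `x_e ∈ P^{b-e}` for all `e < b`
(`Δ_c P^b ⊆ P^{b-c}`, `apply_mem_pow_sub`, and induction on `e`). [folklore] -/
theorem mem_pow_sub_of_op_eq_sum (P : Ideal A) {b : ℕ} {f : A} (hf : f ∈ P ^ b) {x : ℕ → A}
    (hΔ : ∀ c < b, ∃ t : ℕ → A, t c = 1 ∧ Δ.op c f = ∑ e ∈ Finset.range (c + 1), x e * t e) :
    ∀ e < b, x e ∈ P ^ (b - e) := by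
  intro e
  induction e using Nat.strong_induction_on with
  | _ e ih =>
    intro he
    obtain ⟨t, ht1, ht⟩ := hΔ e he
    have hsum : x e = Δ.op e f - ∑ e' ∈ Finset.range e, x e' * t e' := by
      rw [ht, Finset.sum_range_succ, ht1, mul_one]; ring
    rw [hsum]
    refine sub_mem (Δ.apply_mem_pow_sub P hf e) (Ideal.sum_mem _ fun e' he' => ?_)
    have he'e : e' < e := Finset.mem_range.mp he'
    exact Ideal.mul_mem_right _ _ (Ideal.pow_le_pow_right (by omega) (ih e' he'e (by omega)))

/-- **Root extraction modulo a regular parameter**: in a regular local ring, `u ∈ 𝔪 ∖ 𝔪²`, `N ≥ 1`,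
`x^N ∈ 𝔪^{N m} + (u) ⟹ x ∈ 𝔪^m + (u)` (the order function of the regular local ring `A/(u)`;
`Ideal.pow_le_pow_mul_sup_span_iff`). [cite: Matsumura1987, Thm. 14.2] -/
theorem mem_pow_sup_span_of_pow_mem [IsRegularLocalRing A] {u : A} (hu : u ∈ maximalIdeal A)
    (hu2 : u ∉ maximalIdeal A ^ 2) {x : A} {N m : ℕ} (hN : 0 < N)
    (h : x ^ N ∈ maximalIdeal A ^ (N * m) ⊔ Ideal.span {u}) :
    x ∈ maximalIdeal A ^ m ⊔ Ideal.span {u} := by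
  rw [← Ideal.span_singleton_le_iff_mem, ← Ideal.pow_le_pow_mul_sup_span_iff hu hu2 _ hN,
    Ideal.span_singleton_pow, Ideal.span_singleton_le_iff_mem]
  exact h

end Criterion

section TowerCriterion

variable {R : Type u} {K : Type v} [CommRing R] [Field K] [Algebra R K]
  {D : HasseSchmidtDerivation R K} {O : ℕ → Subalgebra R K} {g : ℕ → K} {k : ℕ}

/-- **Two-sided order criterion at the top of a tower** (the stage-`k` step of the LSB clause of an ambient
reduction to a smooth hypersurface, every characteristic, every field).  Let `O_k` be a regular local ring,
`u = u_k G_k` with `u_k ∈ 𝔪_k`, `D_1 u ∈ O_k` a unit of `O_k`, and let `f_k = f G_k^{-b}` and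
`x_e = (D_e f) G_k^{-(b-e)}` (`e < b`) lie in `O_k`.  Then
`f_k ∈ 𝔪_k^b ⟺ ∀ e < b, x_e^{b!/(b-e)} ∈ 𝔪_k^{b!} + (u_k)`.
(⟹: the unitriangular tower Giraud system, `mem_pow_sub_of_op_eq_sum`.  ⟸: `u_k ∉ 𝔪_k²` by transversality
(`isUnit_towerDeriv_op_one`, `isUnit_op_one_not_mem_sq`), root extraction in `O_k/(u_k)`, and the transverse-order
core through the system, `mem_pow_of_op_eq_sum`.)
[cite: BravoGarciaEscamillaVillamayor2012, Prop. 6.9]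
[cite: Hironaka2017, Th. 3.10 (p. 10; unrefereed manuscript — the stage-k step of its LSB clause for a hypersurface W; the sequence-level assembly is not asserted here)] -/
theorem IsChartTower.mem_pow_iff_forall_pow_mem_sup (h : IsChartTower D O g k) [IsRegularLocalRing (O k)]
    {u f : K} {b : ℕ} (uk d fk : O k) (x : ℕ → O k)
    (huk : (uk : K) * tprod g k = u) (hum : uk ∈ maximalIdeal (O k))
    (hd : (d : K) = D.op 1 u) (hdU : IsUnit d)
    (hfk : (fk : K) = f * (tprod g k ^ b)⁻¹)
    (hx : ∀ e < b, (x e : K) = D.op e f * (tprod g k ^ (b - e))⁻¹) :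
    fk ∈ maximalIdeal (O k) ^ b ↔
      ∀ e < b, x e ^ (b.factorial / (b - e)) ∈ maximalIdeal (O k) ^ b.factorial ⊔ Ideal.span {uk} := by
  have hsys : ∀ c < b, ∃ t : ℕ → O k, t c = 1 ∧
      (IsChartTower.towerDeriv h).op c fk = ∑ e ∈ Finset.range (c + 1), x e * t e := fun c hc =>
    ⟨fun e => IsChartTower.towerCoeff h b (c - e), by
      dsimp only; rw [Nat.sub_self, IsChartTower.towerCoeff_zero],
      IsChartTower.towerDeriv_op_eq_sum h hc.le fk x hfk fun e hec => hx e (by omega)⟩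
  have hdiv : ∀ e < b, 0 < b.factorial / (b - e) ∧ b.factorial / (b - e) * (b - e) = b.factorial := fun e he =>
    ⟨Nat.div_pos (Nat.le_of_dvd (Nat.factorial_pos b) (Nat.dvd_factorial (by omega) (by omega))) (by omega),
      Nat.div_mul_cancel (Nat.dvd_factorial (by omega) (by omega))⟩
  constructor
  · intro hP e he
    have hxe : x e ∈ maximalIdeal (O k) ^ (b - e) :=
      (IsChartTower.towerDeriv h).mem_pow_sub_of_op_eq_sum (maximalIdeal (O k)) hP
        (fun c hc => hsys c hc) e he
    have hxe' : x e ^ (b.factorial / (b - e)) ∈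
        maximalIdeal (O k) ^ ((b - e) * (b.factorial / (b - e))) := by
      rw [pow_mul]; exact Ideal.pow_mem_pow hxe _
    rw [Nat.mul_div_cancel' (Nat.dvd_factorial (by omega) (by omega))] at hxe'
    exact Ideal.mem_sup_left hxe'
  · intro hQ
    have hU : IsUnit ((IsChartTower.towerDeriv h).op 1 uk) :=
      IsChartTower.isUnit_towerDeriv_op_one h uk d huk hum hd hdU
    have hu2 : uk ∉ maximalIdeal (O k) ^ 2 := (IsChartTower.towerDeriv h).isUnit_op_one_not_mem_sq hU
    refine (IsChartTower.towerDeriv h).mem_pow_of_op_eq_sum hum hU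
      (fun c hc => (hsys c hc).imp fun t ht => ht.2) fun e he => ?_
    refine mem_pow_sup_span_of_pow_mem hum hu2 (hdiv e he).1 ?_
    rw [(hdiv e he).2]
    exact hQ e he

end TowerCriterion

end HasseSchmidtDerivation

end Literature.AlgebraicGeometry.Resolution
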